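import Summits.AtomisticToContinuum.Crystallization.Theorems.OverbindingBudgetAffineRunCutSheetLetter

/-!
# `OverbindingBudget` / crux `RobustDefectLimitWindows` (stmt-AtomisticToContinuum-31280) — «RunCut»: SHEET WALKS, part A (one-step kinematics, abstract inductions)

Support file (lens-4 g88, part 20A; memo `g88/memo/UNIAX-g88.md` §3 (W1), order (2c), radius ruling r1587 (A): ρ₁ = 30).  The pointwise
sheet engine walks along BASAL CHAINS of h-sites `c 0, c 1, …, c K` (each `c (t+1) = f_t(u_t)` for a basal position `u_t` of the hcp chart
at `c t`; by the tree's `basal_step_record` (A) every `c t` is an h-site).  This file proves what is transported along such a chain, from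
part 16's one-step record `basal_step_record` (B)(C)(D) and pointwise affine registration only — no datum, no layer rigidity:

§1 one-step kinematics of a basal bond `s = y m′ − y m` (section `BasalStep`, the hypotheses of `…RunCutSheetLetter`):
* `inner_eclipsed_basal` — `⟪a, u⟫ = 0` for the eclipsed-pair vector `a = (4,4,4)/√18` and a basal pattern point `u` (polarisation on the cap pair);
* `frame_axis_close` — an hcp chart's frame is `2/1000`-close to its isometry at `a`; `frame_axis_norm` — `1.6309 ≤ ‖A a‖ ≤ 1.635`;
* `basal_neg_mem` — the basal hexagon is centrally symmetric (`−u` is a basal pattern point; straight continuation of walks);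
* `basal_step_kinematics` — ★ `‖s − ν A u‖ ≤ 10⁻⁴ν`, `0.9989ν ≤ ‖s‖ ≤ 1.0011ν`, `‖s‖ ≤ 1.0011ν′` (the bond read from the far end, (B)),
  `|⟪ν A a, s⟫| ≤ 0.0038 ν²` (the bond is in the basal plane up to the affine distortion: `⟪Q a, Q u⟫ = 0`), and `m′ ≠ m`;
* `straight_continuation` — continuing through `m′` along `−x₀` (the back-vector negated) repeats the step vector to `2·10⁻⁴ν′`.
§2 abstract inductions (pure vector bookkeeping, any sequences `p x : ℕ → E3`, `ν : ℕ → ℝ`):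
* `sign_step`, `inner_step` — sign (mirror-gauge) bookkeeping helpers;
* `walk_induction` — ★★ from the per-step facts ((C) `p_{t+1} ≈ ±p_t` to `2·10⁻⁴(ν_t+ν_{t+1})`, (D), `1.6309ν_t ≤ ‖p_t‖ ≤ 1.635ν_t`,
  `‖s_t‖ ≤ 1.0011ν_t`, `|⟪p_t, s_t⟫| ≤ 0.0038ν_t²`) along `K ≤ 60` steps: (i) LINEAR scale window `|ν_t − ν_0| ≤ (0.0026 + 3·10⁻⁴t)ν_0`
  (no compounding: the physical axis vector `p_t = ν_t A_t a` is transported, the `θ`-slack enters once), (ii) axis transport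
  `‖p_t ∓ p_0‖ ≤ 4.1·10⁻⁴ t ν_0`, (iii) height over the start plane `|⟪p_0, x_t − x_0⟫| ≤ (2.1·10⁻⁴t² + 4·10⁻³t) ν_0²`;
* `straight_induction` — a walk whose consecutive step vectors agree to `2·10⁻⁴ν` stays within `10⁻⁴ t² ν̄` of the straight line `x_0 + t s_0`.
§3 (the chart-level record `sheet_walk_record` / `sheet_walk_height`) is part 20B `…RunCutSheetWalk`.
[this file: 0 definitions, 13 theorems; imports tree `…RunCutSheetLetter` only; standard axioms]
-/

namespace Summit.AtomisticToContinuum.Crystallization.Theorems.OverbindingBudgetAffineRunCutSheetWalkA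

open scoped InnerProductSpace
open Literature.Geometry.DiscreteGeometry
open Summit.AtomisticToContinuum.Crystallization.Theorems.OverbindingBudgetAffineRunCutSheetLetterA
open Summit.AtomisticToContinuum.Crystallization.Theorems.OverbindingBudgetAffineRunCutSheetLetter
open Summit.AtomisticToContinuum.Crystallization.Theorems.OverbindingBudgetAffineCompressedCutEstablish (nearestDist_pos_of_frame)

variable {N : ℕ}

local notation "E3" => EuclideanSpace ℝ (Fin 3)

/-! ## §1 One-step kinematics -/

/-- `⟪a, u⟫ = 0` for the eclipsed-pair vector `a = (4,4,4)/√18` and a basal pattern point `u` (`a = w₁ − w₂` for the caps `w₁, w₂` over a basal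
triangle at `u`, both at distance `1` from `u` and of norm `1`: polarisation). [this file · kind: proof] -/
theorem inner_eclipsed_basal {u : E3} (hu : u ∈ hcpTwoShellPattern) (hu0 : u 0 + u 1 + u 2 = 0) :
    ⟪((Real.sqrt 18)⁻¹ • intVec ![4, 4, 4] : E3), u⟫_ℝ = 0 := by
  obtain ⟨w₁, hw₁, w₂, hw₂, hn₁, hn₂, hd₁, hd₂, hww⟩ := hcpTwoShellPattern_basal_cap_pair hu hu0
  have hu1 : ‖u‖ = 1 := norm_eq_one_of_basal hu hu0
  have h1 : ⟪w₁, u⟫_ℝ = 1 / 2 := by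
    have e : ‖w₁ - u‖ ^ 2 = ‖w₁‖ ^ 2 - 2 * ⟪w₁, u⟫_ℝ + ‖u‖ ^ 2 := norm_sub_sq_real w₁ u
    rw [← dist_eq_norm, hd₁, hn₁, hu1] at e; linarith
  have h2 : ⟪w₂, u⟫_ℝ = 1 / 2 := by
    have e : ‖w₂ - u‖ ^ 2 = ‖w₂‖ ^ 2 - 2 * ⟪w₂, u⟫_ℝ + ‖u‖ ^ 2 := norm_sub_sq_real w₂ u
    rw [← dist_eq_norm, hd₂, hn₂, hu1] at e; linarith
  rw [← hww, inner_sub_left, h1, h2, sub_self]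

/-- **`1.6309 ≤ ‖A a‖ ≤ 1.635`** for a frame `2/1000`-close to an isometry at `a`. [this file · kind: glue] -/
theorem frame_axis_norm {Q : E3 →ₗᵢ[ℝ] E3} {A : E3 →ₗ[ℝ] E3}
    (hAQ : ‖A ((Real.sqrt 18)⁻¹ • intVec ![4, 4, 4]) - Q ((Real.sqrt 18)⁻¹ • intVec ![4, 4, 4])‖ ≤ 2 / 1000) :
    (16309 / 10000 : ℝ) ≤ ‖A ((Real.sqrt 18)⁻¹ • intVec ![4, 4, 4])‖ ∧ ‖A ((Real.sqrt 18)⁻¹ • intVec ![4, 4, 4])‖ ≤ 1635 / 1000 := by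
  set a : E3 := (Real.sqrt 18)⁻¹ • intVec ![4, 4, 4] with hadef
  obtain ⟨haL, haU⟩ := norm_eclipsedVec_bounds
  rw [← hadef] at haL haU
  have h := abs_norm_sub_norm_le (A a) (Q a)
  rw [Q.norm_map, abs_le] at h
  constructor <;> linarith [h.1, h.2, hAQ]

/-- The integer model: the basal hexagon is centrally symmetric (the six basal points of `hcpModelInt` are the equator
`…ChargedEnergyGapTwinWallsA.hcpEquatorInt`, cf. `…ChargedEnergyGapTwinRows.neg_mem_hcpEquatorInt` — a different import cone, not imported here).
[this file · kind: computation] -/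
theorem hcpModelInt_neg_of_basal : ∀ v ∈ hcpModelInt, v 0 + v 1 + v 2 = 0 → -v ∈ hcpModelInt := by
  decide

/-- **The basal hexagon is centrally symmetric**: `−u` is a basal point of `hcpTwoShellPattern` whenever `u` is. [this file · kind: proof] -/
theorem basal_neg_mem {u : E3} (hu : u ∈ hcpTwoShellPattern) (hu0 : u 0 + u 1 + u 2 = 0) :
    -u ∈ hcpTwoShellPattern ∧ (-u) 0 + (-u) 1 + (-u) 2 = 0 := by
  refine ⟨?_, ?_⟩
  · rw [hcpTwoShellPattern_eq_image] at hu ⊢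
    obtain ⟨U, hU, rfl⟩ := Finset.mem_image.1 hu
    simp only [Nat.cast_ofNat] at hu0 ⊢
    have hU0 : U 0 + U 1 + U 2 = 0 := (coordSum_eq_zero_iff U).1 hu0
    refine Finset.mem_image.2 ⟨-U, hcpModelInt_neg_of_basal U hU hU0, ?_⟩
    rw [← smul_neg]
    congr 1
    ext i
    simp [intVec]
  · have e : ∀ i, (-u) i = -(u i) := fun i => rfl
    rw [e, e, e]; linarith

/-- The integer model: `(3, −3, 0)` is a basal point. [this file · kind: computation] -/
theorem hcpModelInt_mem_basal₀ : (![3, -3, 0] : Fin 3 → ℤ) ∈ hcpModelInt := by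
  decide

/-- ★ **An hcp chart's frame is `2/1000`-close to its isometry at the eclipsed-pair vector** `a = (4,4,4)/√18` (from `1/1000` at the pattern:
`a = w₁ − w₂` for a cap pair over the basal point `(3,−3,0)/√18`). [this file · kind: proof] -/
theorem frame_axis_close {Q : E3 →ₗᵢ[ℝ] E3} {A : E3 →ₗ[ℝ] E3} (hA : ∀ v ∈ hcpTwoShellPattern, ‖A v - Q v‖ ≤ 1 / 1000) :
    ‖A ((Real.sqrt 18)⁻¹ • intVec ![4, 4, 4]) - Q ((Real.sqrt 18)⁻¹ • intVec ![4, 4, 4])‖ ≤ 2 / 1000 := by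
  set u₀ : E3 := (Real.sqrt 18)⁻¹ • intVec ![3, -3, 0] with hu₀def
  have hu₀ : u₀ ∈ hcpTwoShellPattern := by
    rw [hcpTwoShellPattern_eq_image]; simp only [Nat.cast_ofNat]
    exact Finset.mem_image_of_mem _ hcpModelInt_mem_basal₀
  have hu₀0 : u₀ 0 + u₀ 1 + u₀ 2 = 0 := by
    simp [hu₀def, intVec]
  obtain ⟨w₁, hw₁, w₂, hw₂, -, -, -, -, hww⟩ := hcpTwoShellPattern_basal_cap_pair hu₀ hu₀0
  rw [← hww, map_sub, map_sub]
  have e : A w₁ - A w₂ - (Q w₁ - Q w₂) = (A w₁ - Q w₁) - (A w₂ - Q w₂) := by abel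
  rw [e]
  linarith [norm_sub_le (A w₁ - Q w₁) (A w₂ - Q w₂), hA w₁ hw₁, hA w₂ hw₂]

section BasalStep

/-! The chart data of a basal step (as in `…RunCutSheetLetter`): an h-chart `(Q, A, f)` at `m`, any chart `(P′, Q′, A′, f′)` at `m′`, and
`m′ = f u` at a basal position `u` of `m`. -/
variable {y : Fin N → E3} (hy : Function.Injective y) {m m' : Fin N}
  {Q : E3 →ₗᵢ[ℝ] E3} {A : E3 →ₗ[ℝ] E3} {f : E3 → E3}
  (hA : ∀ v ∈ hcpTwoShellPattern, ‖A v - Q v‖ ≤ 1 / 1000)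
  (hf : ∀ v ∈ hcpTwoShellPattern, f v ∈ Set.range y ∧ dist (f v) (y m + nearestDist y m • A v) ≤ 1 / 10 ^ 4 * nearestDist y m)
  (hinj : Set.InjOn f ↑hcpTwoShellPattern)
  (hex : ∀ k : Fin N, k ≠ m → dist (y k) (y m) ≤ (3 / 2 + 1 / 450) * nearestDist y m → ∃ v ∈ hcpTwoShellPattern, f v = y k)
  {P' : Finset E3} {Q' : E3 →ₗᵢ[ℝ] E3} {A' : E3 →ₗ[ℝ] E3} {f' : E3 → E3}
  (hP' : P' = fccTwoShellPattern ∨ P' = hcpTwoShellPattern)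
  (hA' : ∀ v ∈ P', ‖A' v - Q' v‖ ≤ 1 / 1000)
  (hf' : ∀ v ∈ P', f' v ∈ Set.range y ∧ dist (f' v) (y m' + nearestDist y m' • A' v) ≤ 1 / 10 ^ 4 * nearestDist y m')
  (hinj' : Set.InjOn f' ↑P')
  (hex' : ∀ k : Fin N, k ≠ m' → dist (y k) (y m') ≤ (3 / 2 + 1 / 450) * nearestDist y m' → ∃ v ∈ P', f' v = y k)
  {u : E3} (hu : u ∈ hcpTwoShellPattern) (hu0 : u 0 + u 1 + u 2 = 0) (hmu : f u = y m')

include hy hA hf hinj hex hP' hA' hf' hinj' hex' hu hu0 hmu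

/-- ★ **ONE-STEP KINEMATICS of a basal bond** `s = y m′ − y m` (`ν = ν_m`, `ν′ = ν_{m′}`, `a = (4,4,4)/√18`): registration `‖s − ν A u‖ ≤ 10⁻⁴ν`,
length `0.9989ν ≤ ‖s‖ ≤ 1.0011ν` and `‖s‖ ≤ 1.0011ν′` (read from the far end through (B)), in-plane `|⟪ν A a, s⟫| ≤ 0.0038ν²` (from
`⟪Q a, Q u⟫ = ⟪a, u⟫ = 0` and the `θ`-closeness of `A`), and `m′ ≠ m`. [this file · kind: proof] -/
theorem basal_step_kinematics :
    ‖(y m' - y m) - nearestDist y m • A u‖ ≤ 1 / 10 ^ 4 * nearestDist y m ∧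
    9989 / 10000 * nearestDist y m ≤ ‖y m' - y m‖ ∧ ‖y m' - y m‖ ≤ 10011 / 10000 * nearestDist y m ∧
    ‖y m' - y m‖ ≤ 10011 / 10000 * nearestDist y m' ∧
    |⟪nearestDist y m • A ((Real.sqrt 18)⁻¹ • intVec ![4, 4, 4]), y m' - y m⟫_ℝ| ≤ 38 / 10000 * nearestDist y m ^ 2 ∧
    m' ≠ m := by
  set ν := nearestDist y m with hνdef
  set ν' := nearestDist y m' with hν'def
  set a : E3 := (Real.sqrt 18)⁻¹ • intVec ![4, 4, 4] with hadef
  set s : E3 := y m' - y m with hsdef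
  have hν : 0 < ν := nearestDist_pos_of_frame hy (Or.inr rfl) (fun v hv => (hf v hv).1) hinj
  obtain ⟨hPh, ⟨x₀, hx₀, hx₀0, hfx₀⟩, -, hAQ, -, hlo, hhi⟩ := basal_step_record hy hA hf hinj hex hP' hA' hf' hinj' hex' hu hu0 hmu
  have hν' : 0 < ν' := by rw [hν'def]; linarith
  have hu1 : ‖u‖ = 1 := norm_eq_one_of_basal hu hu0
  -- registration of the step in the chart of `m`
  have K1 : ‖s - ν • A u‖ ≤ 1 / 10 ^ 4 * ν := by
    have := (hf u hu).2
    rwa [hmu, dist_eq_norm, ← sub_sub] at this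
  -- `‖A u‖ = 1 ± 1/1000`
  have hAu : |‖A u‖ - 1| ≤ 1 / 1000 := by
    have h := (abs_norm_sub_norm_le (A u) (Q u)).trans (hA u hu); rwa [Q.norm_map, hu1] at h
  rw [abs_le] at hAu
  have hνAu : ‖ν • A u‖ = ν * ‖A u‖ := by rw [norm_smul, Real.norm_of_nonneg hν.le]
  have K2U : ‖s‖ ≤ 10011 / 10000 * ν := by
    have h1 : ‖s‖ ≤ ‖s - ν • A u‖ + ‖ν • A u‖ := by
      have := norm_add_le (s - ν • A u) (ν • A u); rwa [sub_add_cancel] at this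
    rw [hνAu] at h1; nlinarith [hAu.2, hν.le]
  have K2L : 9989 / 10000 * ν ≤ ‖s‖ := by
    have h1 : ‖ν • A u‖ ≤ ‖ν • A u - s‖ + ‖s‖ := by
      have := norm_add_le (ν • A u - s) s; rwa [sub_add_cancel] at this
    rw [norm_sub_rev, hνAu] at h1; nlinarith [hAu.1, hν.le]
  -- the bond read from the far end (B)
  have K3 : ‖s‖ ≤ 10011 / 10000 * ν' := by
    have hx₀' : x₀ ∈ P' := by rw [hPh]; exact hx₀
    have hA'P : ∀ v ∈ hcpTwoShellPattern, ‖A' v - Q' v‖ ≤ 1 / 1000 := by rw [← hPh]; exact hA'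
    have r := (hf' x₀ hx₀').2
    rw [hfx₀, dist_eq_norm, ← sub_sub] at r
    have hx₀1 : ‖x₀‖ = 1 := norm_eq_one_of_basal hx₀ hx₀0
    have hAx : |‖A' x₀‖ - 1| ≤ 1 / 1000 := by
      have h := (abs_norm_sub_norm_le (A' x₀) (Q' x₀)).trans (hA'P x₀ hx₀); rwa [Q'.norm_map, hx₀1] at h
    rw [abs_le] at hAx
    have hνAx : ‖ν' • A' x₀‖ = ν' * ‖A' x₀‖ := by rw [norm_smul, Real.norm_of_nonneg hν'.le]
    have h1 : ‖y m - y m'‖ ≤ ‖y m - y m' - ν' • A' x₀‖ + ‖ν' • A' x₀‖ := by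
      have := norm_add_le (y m - y m' - ν' • A' x₀) (ν' • A' x₀); rwa [sub_add_cancel] at this
    rw [hsdef, norm_sub_rev]
    rw [hνAx] at h1; nlinarith [hAx.2, hν'.le]
  -- in-plane: `|⟪ν A a, s⟫| ≤ 0.0038 ν²`
  have K4 : |⟪ν • A a, s⟫_ℝ| ≤ 38 / 10000 * ν ^ 2 := by
    obtain ⟨haL, haU⟩ := norm_eclipsedVec_bounds
    rw [← hadef] at haL haU
    obtain ⟨hAaL, hAaU⟩ := frame_axis_norm hAQ
    have hsplit : ⟪ν • A a, s⟫_ℝ = ν * ⟪A a, s - ν • A u⟫_ℝ + ν * (ν * ⟪A a, A u⟫_ℝ) := by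
      rw [real_inner_smul_left, ← real_inner_smul_right (A a) (A u) ν, ← mul_add, ← inner_add_right, sub_add_cancel]
    have e : ⟪A a, A u⟫_ℝ = ⟪Q a, A u - Q u⟫_ℝ + ⟪A a - Q a, A u⟫_ℝ := by
      rw [inner_sub_right, inner_sub_left, Q.inner_map_map, inner_eclipsed_basal hu hu0]; ring
    have t1 : |⟪Q a, A u - Q u⟫_ℝ| ≤ 1633 / 1000 * (1 / 1000) := by
      refine (abs_real_inner_le_norm _ _).trans ?_
      rw [Q.norm_map]
      exact mul_le_mul haU (hA u hu) (norm_nonneg _) (by norm_num)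
    have t2 : |⟪A a - Q a, A u⟫_ℝ| ≤ 2 / 1000 * (1001 / 1000) := by
      refine (abs_real_inner_le_norm _ _).trans ?_
      exact mul_le_mul hAQ (by linarith [hAu.2]) (norm_nonneg _) (by norm_num)
    have t3 : |⟪A a, A u⟫_ℝ| ≤ 3635 / 1000000 := by
      rw [e]; refine (abs_add_le _ _).trans ?_; linarith
    have t4 : |⟪A a, s - ν • A u⟫_ℝ| ≤ 1635 / 1000 * (1 / 10 ^ 4 * ν) :=
      (abs_real_inner_le_norm _ _).trans (mul_le_mul hAaU K1 (norm_nonneg _) (by norm_num))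
    rw [hsplit]
    refine (abs_add_le _ _).trans ?_
    rw [abs_mul, abs_of_pos hν, abs_mul, abs_of_pos hν, abs_mul, abs_of_pos hν]
    nlinarith [t3, t4, hν.le, abs_nonneg ⟪A a, A u⟫_ℝ, abs_nonneg ⟪A a, s - ν • A u⟫_ℝ]
  have K6 : m' ≠ m := by
    intro h
    rw [hsdef, h, sub_self, norm_zero] at K2L
    linarith
  exact ⟨K1, K2L, K2U, K3, K4, K6⟩

omit hy hA hf hinj hex hP' hA' hinj' hex' hu hu0 hmu in
/-- ★ **STRAIGHT CONTINUATION.**  If `x₀` is the back-vector of the step at `m′` (`f′ x₀ = y m`, (B)) and `m″ = f′ (−x₀)` is the site straight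
ahead, the new step vector repeats the old one to registration accuracy: `‖(y m″ − y m′) − (y m′ − y m)‖ ≤ 2·10⁻⁴ ν_{m′}` (no `θ`-term: the
two registrations are in the SAME chart). [this file · kind: proof] -/
theorem straight_continuation {x₀ : E3} (hx₀ : x₀ ∈ P') (hfx₀ : f' x₀ = y m) (hnx₀ : -x₀ ∈ P') {m'' : Fin N} (hm'' : f' (-x₀) = y m'') :
    ‖(y m'' - y m') - (y m' - y m)‖ ≤ 2 / 10 ^ 4 * nearestDist y m' := by
  have r₀ := (hf' x₀ hx₀).2
  rw [hfx₀, dist_eq_norm] at r₀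
  have r₁ := (hf' (-x₀) hnx₀).2
  rw [hm'', dist_eq_norm] at r₁
  have e : (y m'' - y m') - (y m' - y m) = (y m'' - (y m' + nearestDist y m' • A' (-x₀))) + (y m - (y m' + nearestDist y m' • A' x₀)) := by
    rw [map_neg, smul_neg]; abel
  rw [e]
  exact (norm_add_le _ _).trans (by linarith)

end BasalStep

/-! ## §2 Abstract inductions (vector bookkeeping along a chain) -/

/-- Sign (mirror-gauge) bookkeeping: `P′ ≈ ±P` and `P ≈ σ P₀` give `P′ ≈ σ′ P₀`. [this file · kind: glue] -/
theorem sign_step {P P' P₀ : E3} {σ e d : ℝ} (hσ : σ = 1 ∨ σ = -1) (hC : ‖P - P'‖ ≤ e ∨ ‖P + P'‖ ≤ e) (h : ‖P - σ • P₀‖ ≤ d) :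
    ∃ σ' : ℝ, (σ' = 1 ∨ σ' = -1) ∧ ‖P' - σ' • P₀‖ ≤ e + d := by
  rcases hC with hC | hC
  · refine ⟨σ, hσ, ?_⟩
    have e1 : P' - σ • P₀ = (P - σ • P₀) - (P - P') := by abel
    rw [e1]; linarith [norm_sub_le (P - σ • P₀) (P - P')]
  · refine ⟨-σ, by rcases hσ with h | h <;> norm_num [h], ?_⟩
    have e1 : P' - (-σ) • P₀ = (P + P') - (P - σ • P₀) := by rw [neg_smul]; abel
    rw [e1]; linarith [norm_sub_le (P + P') (P - σ • P₀)]

/-- `‖σ • P‖ = ‖P‖` for a sign `σ`. [this file · kind: glue] -/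
theorem norm_sign_smul {σ : ℝ} (hσ : σ = 1 ∨ σ = -1) (P : E3) : ‖σ • P‖ = ‖P‖ := by
  rcases hσ with h | h <;> simp [h]

/-- Height increments through the transported axis: `|⟪P₀, s⟫| ≤ ‖P − σP₀‖·‖s‖ + |⟪P, s⟫|`. [this file · kind: glue] -/
theorem inner_step {P₀ P s : E3} {σ d : ℝ} (hσ : σ = 1 ∨ σ = -1) (h : ‖P - σ • P₀‖ ≤ d) :
    |⟪P₀, s⟫_ℝ| ≤ d * ‖s‖ + |⟪P, s⟫_ℝ| := by
  have h1 : |⟪σ • P₀, s⟫_ℝ| = |⟪P₀, s⟫_ℝ| := by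
    rw [real_inner_smul_left, abs_mul]; rcases hσ with h | h <;> simp [h]
  have e : ⟪σ • P₀, s⟫_ℝ = ⟪P, s⟫_ℝ - ⟪P - σ • P₀, s⟫_ℝ := by rw [inner_sub_left]; ring
  rw [← h1, e]
  have h2 : |⟪P - σ • P₀, s⟫_ℝ| ≤ d * ‖s‖ :=
    (abs_real_inner_le_norm _ _).trans (mul_le_mul_of_nonneg_right h (norm_nonneg s))
  have h3 := abs_sub (⟪P, s⟫_ℝ) (⟪P - σ • P₀, s⟫_ℝ)
  linarith

/-- ★★ **WALK INDUCTION (abstract).**  Sequences `p` (transported axis vectors), `x` (positions), `ν` (scales) with the per-step facts of a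
basal chain — (C) `p_{t+1} ≈ ±p_t` to `2·10⁻⁴(ν_t+ν_{t+1})`, (D) `ν_{t+1} ≤ 1.0011 ν_t`, `1.6309ν_t ≤ ‖p_t‖ ≤ 1.635ν_t`, step length
`≤ 1.0011ν_t`, in-plane `|⟪p_t, s_t⟫| ≤ 0.0038ν_t²` — satisfy for `t ≤ K ≤ 60`: (i) `|ν_t − ν_0| ≤ (0.0026 + 3·10⁻⁴ t) ν_0` (LINEAR: the
axis VECTOR is transported, so the `θ`-slack `1.635/1.6309` enters once), (ii) `‖p_t − σp_0‖ ≤ 4.1·10⁻⁴ t ν_0` for a sign `σ`, (iii)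
`|⟪p_0, x_t − x_0⟫| ≤ (2.1·10⁻⁴ t² + 4·10⁻³ t) ν_0²`. [this file · kind: proof] -/
theorem walk_induction (p x : ℕ → E3) (ν : ℕ → ℝ) (K : ℕ) (hK : K ≤ 60) (hν0 : 0 < ν 0)
    (hC : ∀ t, t < K → ‖p t - p (t + 1)‖ ≤ 2 / 10 ^ 4 * (ν t + ν (t + 1)) ∨ ‖p t + p (t + 1)‖ ≤ 2 / 10 ^ 4 * (ν t + ν (t + 1)))
    (hD : ∀ t, t < K → ν (t + 1) ≤ 10011 / 10000 * ν t)
    (hP : ∀ t, t ≤ K → 16309 / 10000 * ν t ≤ ‖p t‖ ∧ ‖p t‖ ≤ 1635 / 1000 * ν t)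
    (hS : ∀ t, t < K → ‖x (t + 1) - x t‖ ≤ 10011 / 10000 * ν t)
    (hT : ∀ t, t < K → |⟪p t, x (t + 1) - x t⟫_ℝ| ≤ 38 / 10000 * ν t ^ 2) :
    ∀ t, t ≤ K → |ν t - ν 0| ≤ (26 / 10000 + 3 / 10000 * t) * ν 0 ∧
      (∃ σ : ℝ, (σ = 1 ∨ σ = -1) ∧ ‖p t - σ • p 0‖ ≤ 41 / 100000 * t * ν 0) ∧
      |⟪p 0, x t - x 0⟫_ℝ| ≤ (21 / 100000 * t ^ 2 + 4 / 1000 * t) * ν 0 ^ 2 := by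
  intro t
  induction t with
  | zero =>
    intro _
    refine ⟨?_, ⟨1, Or.inl rfl, ?_⟩, ?_⟩
    · rw [sub_self, abs_zero]; positivity
    · simp
    · simp
  | succ t ih =>
    intro ht
    have htK : t < K := Nat.lt_of_succ_le ht
    obtain ⟨hi, ⟨σ, hσ, hii⟩, hiii⟩ := ih htK.le
    have ht59 : (t : ℝ) ≤ 59 := by exact_mod_cast (by omega : t ≤ 59)
    have ht0 : (0 : ℝ) ≤ t := by exact_mod_cast Nat.zero_le t
    rw [abs_le] at hi
    -- scale bounds at `t` and `t+1`
    have hνt : ν t ≤ 10203 / 10000 * ν 0 := by nlinarith [hi.2, hν0.le]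
    have hνt0 : 0 ≤ ν t := by nlinarith [hi.1, hν0.le]
    have hνt1 : ν (t + 1) ≤ 10215 / 10000 * ν 0 := by linarith [hD t htK]
    -- (ii) axis transport
    obtain ⟨σ', hσ', h2⟩ := sign_step hσ (hC t htK) hii
    have h2' : ‖p (t + 1) - σ' • p 0‖ ≤ 41 / 100000 * (t + 1 : ℕ) * ν 0 := by
      push_cast; nlinarith [h2, hνt, hνt1, hν0.le]
    -- (i) linear scale window at `t+1`
    have hn : |‖p (t + 1)‖ - ‖p 0‖| ≤ 41 / 100000 * (t + 1 : ℕ) * ν 0 := by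
      have := abs_norm_sub_norm_le (p (t + 1)) (σ' • p 0); rw [norm_sign_smul hσ'] at this; exact this.trans h2'
    push_cast at hn h2' ⊢
    rw [abs_le] at hn
    obtain ⟨hP0L, hP0U⟩ := hP 0 (Nat.zero_le K)
    obtain ⟨hP1L, hP1U⟩ := hP (t + 1) ht
    have hprod : 0 ≤ (t : ℝ) * ν 0 := mul_nonneg ht0 hν0.le
    have hi' : |ν (t + 1) - ν 0| ≤ (26 / 10000 + 3 / 10000 * ((t : ℝ) + 1)) * ν 0 := by
      rw [abs_le]; constructor
      · nlinarith [hn.1, hP1U, hP0L, hprod, hν0.le]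
      · nlinarith [hn.2, hP1L, hP0U, hprod, hν0.le]
    -- (iii) height
    have h3 := inner_step (s := x (t + 1) - x t) hσ hii
    have hTt := hT t htK
    have hSt := hS t htK
    have e3 : x (t + 1) - x 0 = (x t - x 0) + (x (t + 1) - x t) := by abel
    have hsq : ν t ^ 2 ≤ (10203 / 10000) ^ 2 * ν 0 ^ 2 := by
      rw [← mul_pow]; exact pow_le_pow_left₀ hνt0 hνt 2
    have hcross : 41 / 100000 * t * ν 0 * ‖x (t + 1) - x t‖ ≤ 41 / 100000 * t * ν 0 * (10011 / 10000 * (10203 / 10000 * ν 0)) :=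
      mul_le_mul_of_nonneg_left (hSt.trans (by nlinarith [hνt])) (by positivity)
    refine ⟨hi', ⟨σ', hσ', h2'⟩, ?_⟩
    rw [e3, inner_add_right]
    refine (abs_add_le _ _).trans ?_
    nlinarith [hiii, h3, hTt, hsq, hcross, hprod, hν0.le, sq_nonneg (ν 0), mul_nonneg hprod hν0.le]

/-- **Straight walks stay on their line.**  If consecutive step vectors agree to `2·10⁻⁴ ν_{t+1}` and the scales are `≤ ν̄`, then
`‖(x_t − x_0) − t·(x_1 − x_0)‖ ≤ 10⁻⁴ t² ν̄`. [this file · kind: proof] -/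
theorem straight_induction (x : ℕ → E3) (ν : ℕ → ℝ) (K : ℕ) {νbar : ℝ} (hνbar : 0 ≤ νbar) (hν : ∀ t, t ≤ K → ν t ≤ νbar)
    (hst : ∀ t, t + 1 < K → ‖(x (t + 2) - x (t + 1)) - (x (t + 1) - x t)‖ ≤ 2 / 10 ^ 4 * ν (t + 1)) :
    ∀ t, t ≤ K → ‖(x t - x 0) - (t : ℝ) • (x 1 - x 0)‖ ≤ 1 / 10 ^ 4 * t ^ 2 * νbar := by
  -- step vectors drift linearly
  have hdrift : ∀ i, i < K → ‖(x (i + 1) - x i) - (x 1 - x 0)‖ ≤ 2 / 10 ^ 4 * i * νbar := by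
    intro i
    induction i with
    | zero => intro _; simp
    | succ i ih =>
      intro hi
      have e : (x (i + 1 + 1) - x (i + 1)) - (x 1 - x 0) =
          ((x (i + 2) - x (i + 1)) - (x (i + 1) - x i)) + ((x (i + 1) - x i) - (x 1 - x 0)) := by
        rw [show i + 1 + 1 = i + 2 from rfl]; abel
      rw [e]
      refine (norm_add_le _ _).trans ?_
      have h1 := hst i hi
      have h2 := ih (Nat.lt_of_succ_lt hi)
      have h3 := hν (i + 1) hi.le
      push_cast
      nlinarith
  intro t
  induction t with
  | zero => intro _; simp
  | succ t ih =>
    intro ht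
    have htK : t < K := Nat.lt_of_succ_le ht
    have e : (x (t + 1) - x 0) - ((t + 1 : ℕ) : ℝ) • (x 1 - x 0) =
        ((x t - x 0) - (t : ℝ) • (x 1 - x 0)) + ((x (t + 1) - x t) - (x 1 - x 0)) := by
      push_cast; rw [add_smul, one_smul]; abel
    rw [e]
    refine (norm_add_le _ _).trans ?_
    have h1 := ih htK.le
    have h2 := hdrift t htK
    have ht0 : (0 : ℝ) ≤ t := by exact_mod_cast Nat.zero_le t
    push_cast
    nlinarith

end Summit.AtomisticToContinuum.Crystallization.Theorems.OverbindingBudgetAffineRunCutSheetWalkA
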